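import Literature.NumberTheory.LFunctions.WeilMellinVerticalCalculus
import HarnessLib

/-!
# Preliminaries for the sup-norm sampling theorem on sequences of uniform density

Bookkeeping for `WeilLineSupSampling.lean` (Beurling's compactness proof of the
Duffin–Schaeffer sup-norm sampling inequality `sup_ℝ |Ĝ(1/2+it)| ≤ K sup_n |Ĝ(1/2+iλ_n)|` for
windows `G` supported in `[-b, b]`, `b < π d`, and real sequences `|λ_n - n/d| ≤ M`):

* modulation `G(t) e^{ixt}` translates the transform along the critical line
  (`weilMellin_mul_cexp_ofReal_mul_I`, `isWeilTest_mul_cexp_ofReal_mul_I`,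
  `tsupport_mul_cexp_subset`);
* a priori bounds for a Weil test `V` in terms of a majorant of `|V̂(1/2 + iy)|` on the line, by
  Fourier inversion (`WeilMellinInversion.weilMellin_inversion`): the sup bound
  `‖V u‖ ≤ (2π)⁻¹ ∫ Φ` (`norm_le_of_norm_weilMellin_line_le`) and the Lipschitz bound
  `‖V u - V v‖ ≤ (2π)⁻¹ |u - v| ∫ Ψ` (`norm_sub_le_of_norm_weilMellin_line_le`);
* the transform of a bounded window is Lipschitz along the critical line
  (`norm_weilMellin_line_sub_le`);
* an Arzelà–Ascoli type extraction: a uniformly bounded, uniformly Lipschitz sequence of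
  functions `ℝ → ℂ` together with a sequence in a product of compact intervals indexed by `ℤ` has
  a subsequence converging pointwise everywhere, resp. coordinatewise
  (`exists_subseq_tendsto_of_bounded_lipschitz`; countable-product sequential compactness on
  `ℚ`, then density of `ℚ` and the Lipschitz bound).

Everything is proved (folklore); no definitions, no named facts.
-/

noncomputable section

open Complex Set MeasureTheory Filter Metric
open scoped Real Topology

namespace Literature.NumberTheory.LFunctions

variable {g : ℝ → ℂ}

/-! ### Modulation -/

/-- Modulation translates the transform: `(g(t)e^{ixt})^(s) = ĝ(s + ix)`. [folklore] -/
theorem weilMellin_mul_cexp_ofReal_mul_I (g : ℝ → ℂ) (x : ℝ) (s : ℂ) :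
    weilMellin (fun t => g t * cexp ((x * t : ℝ) * I)) s = weilMellin g (s + x * I) := by
  unfold weilMellin
  congr 1 with t
  rw [mul_assoc, ← Complex.exp_add]
  congr 2
  push_cast
  ring

/-- On the critical line: `(g(t)e^{ixt})^(1/2 + iy) = ĝ(1/2 + i(y + x))`. [folklore] -/
theorem weilMellin_mul_cexp_ofReal_mul_I_half (g : ℝ → ℂ) (x y : ℝ) :
    weilMellin (fun t => g t * cexp ((x * t : ℝ) * I)) (1 / 2 + y * I) =
      weilMellin g (1 / 2 + ((y + x : ℝ) : ℂ) * I) := by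
  rw [weilMellin_mul_cexp_ofReal_mul_I]; congr 1; push_cast; ring

/-- Modulated tests are tests. [folklore] -/
theorem isWeilTest_mul_cexp_ofReal_mul_I (hg : IsWeilTest g) (x : ℝ) :
    IsWeilTest fun t => g t * cexp ((x * t : ℝ) * I) := by
  refine ⟨hg.1.mul ?_, hg.2.mul_right⟩
  have h1 : ContDiff ℝ (⊤ : ℕ∞) fun t : ℝ => ((x * t : ℝ) : ℂ) :=
    Complex.ofRealCLM.contDiff.comp (contDiff_const.mul contDiff_id)
  exact (h1.mul contDiff_const).cexp

/-- Modulation does not enlarge the support. [folklore] -/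
theorem tsupport_mul_cexp_subset (g : ℝ → ℂ) (x : ℝ) :
    tsupport (fun t => g t * cexp ((x * t : ℝ) * I)) ⊆ tsupport g :=
  tsupport_mul_subset_left

/-! ### A priori bounds from a majorant of the transform on the critical line -/

/-- **Sup bound by inversion.** If `‖V̂(1/2 + iy)‖ ≤ Φ(y)` with `Φ` integrable, then
`‖V(u)‖ ≤ (2π)⁻¹ ∫ Φ` for every `u` (`2π V(u) = ∫ V̂(1/2+iy) e^{-iyu} dy`). [folklore] -/
theorem norm_le_of_norm_weilMellin_line_le {V : ℝ → ℂ} (hV : IsWeilTest V) {Φ : ℝ → ℝ}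
    (hΦ : Integrable Φ) (hle : ∀ y : ℝ, ‖weilMellin V (1 / 2 + y * I)‖ ≤ Φ y) (u : ℝ) :
    ‖V u‖ ≤ (2 * π)⁻¹ * ∫ y, Φ y := by
  have hinv := weilMellin_inversion hV (1 / 2) u
  have e : ((1 / 2 : ℝ) : ℂ) = 1 / 2 := by push_cast; ring
  rw [e] at hinv
  simp only [sub_self, zero_mul, Complex.exp_zero, mul_one] at hinv
  have h1 : ‖∫ y : ℝ, weilMellin V (1 / 2 + y * I) * cexp (-(y * I) * u)‖ ≤ ∫ y, Φ y := by
    refine (norm_integral_le_integral_norm _).trans (integral_mono_of_nonneg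
      (Eventually.of_forall fun _ => norm_nonneg _) hΦ (Eventually.of_forall fun y => ?_))
    show ‖weilMellin V (1 / 2 + y * I) * cexp (-(y * I) * u)‖ ≤ Φ y
    rw [norm_mul]
    have h2 : ‖cexp (-(y * I) * u)‖ = 1 := by
      rw [show -((y : ℂ) * I) * u = ((-(y * u) : ℝ) : ℂ) * I by push_cast; ring,
        Complex.norm_exp_ofReal_mul_I]
    rw [h2, mul_one]
    exact hle y
  rw [hinv] at h1
  have hπ : 0 < 2 * π := by positivity
  rw [norm_mul, show ‖(2 : ℂ) * π‖ = 2 * π by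
    rw [norm_mul, Complex.norm_real, Real.norm_of_nonneg Real.pi_pos.le]; simp] at h1
  rw [le_inv_mul_iff₀ hπ]
  exact h1

-- (a copy of `Literature.Probability.Distributions.norm_cexp_mul_I_sub_cexp_mul_I_le`, kept private
-- here to avoid importing the Gaussian-law file into the Weil toolkit)
/-- `|e^{ia} - e^{ib}| ≤ |a - b|` for real `a, b`. [folklore] -/
private theorem norm_cexp_mul_I_sub_cexp_mul_I_le' (a b : ℝ) :
    ‖cexp (a * I) - cexp (b * I)‖ ≤ |a - b| := by
  have h1 : cexp (a * I) - cexp (b * I) = cexp (b * I) * (cexp (((a - b : ℝ) : ℂ) * I) - 1) := by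
    rw [mul_sub, mul_one, ← Complex.exp_add]
    congr 2; push_cast; ring
  rw [h1, norm_mul, Complex.norm_exp_ofReal_mul_I, one_mul]
  have := Real.norm_exp_I_mul_ofReal_sub_one_le (x := a - b)
  rw [mul_comm] at this
  simpa [Real.norm_eq_abs] using this

/-- **Lipschitz bound by inversion.** If `|y| ‖V̂(1/2 + iy)‖ ≤ Ψ(y)` with `Ψ` integrable (and
`V̂` integrable on the line), then `‖V(u) - V(v)‖ ≤ (2π)⁻¹ |u - v| ∫ Ψ`. [folklore] -/
theorem norm_sub_le_of_norm_weilMellin_line_le {V : ℝ → ℂ} (hV : IsWeilTest V) {Ψ : ℝ → ℝ}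
    (hΨ : Integrable Ψ) (hle : ∀ y : ℝ, |y| * ‖weilMellin V (1 / 2 + y * I)‖ ≤ Ψ y) (u v : ℝ) :
    ‖V u - V v‖ ≤ (2 * π)⁻¹ * (|u - v| * ∫ y, Ψ y) := by
  have e : ((1 / 2 : ℝ) : ℂ) = 1 / 2 := by push_cast; ring
  have hu := weilMellin_inversion hV (1 / 2) u
  have hv := weilMellin_inversion hV (1 / 2) v
  rw [e] at hu hv
  simp only [sub_self, zero_mul, Complex.exp_zero, mul_one] at hu hv
  set F : ℝ → ℂ := fun y => weilMellin V (1 / 2 + y * I) with hF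
  have hiu : Integrable fun y : ℝ => F y * cexp (-(y * I) * u) := by
    have := integrable_weilMellin_vertical_mul hV (1 / 2) (F := fun y : ℝ => cexp (-(y * I) * u))
      (by fun_prop) (B := 1) fun y => by
        rw [show -((y : ℂ) * I) * u = ((-(y * u) : ℝ) : ℂ) * I by push_cast; ring,
          Complex.norm_exp_ofReal_mul_I]
    simpa only [e] using this
  have hiv : Integrable fun y : ℝ => F y * cexp (-(y * I) * v) := by
    have := integrable_weilMellin_vertical_mul hV (1 / 2) (F := fun y : ℝ => cexp (-(y * I) * v))
      (by fun_prop) (B := 1) fun y => by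
        rw [show -((y : ℂ) * I) * v = ((-(y * v) : ℝ) : ℂ) * I by push_cast; ring,
          Complex.norm_exp_ofReal_mul_I]
    simpa only [e] using this
  have hdiff : 2 * π * (V u - V v) =
      ∫ y : ℝ, F y * (cexp (-(y * I) * u) - cexp (-(y * I) * v)) := by
    rw [mul_sub, ← hu, ← hv, ← integral_sub hiu hiv]
    congr 1 with y
    ring
  have h1 : ‖∫ y : ℝ, F y * (cexp (-(y * I) * u) - cexp (-(y * I) * v))‖ ≤
      ∫ y, |u - v| * Ψ y := by
    refine (norm_integral_le_integral_norm _).trans (integral_mono_of_nonneg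
      (Eventually.of_forall fun _ => norm_nonneg _) (hΨ.const_mul _)
      (Eventually.of_forall fun y => ?_))
    show ‖F y * (cexp (-(y * I) * u) - cexp (-(y * I) * v))‖ ≤ |u - v| * Ψ y
    rw [norm_mul]
    have h2 : ‖cexp (-(y * I) * u) - cexp (-(y * I) * v)‖ ≤ |y| * |u - v| := by
      have := norm_cexp_mul_I_sub_cexp_mul_I_le' (-(y * u)) (-(y * v))
      rw [show -(y * u) - -(y * v) = -(y * (u - v)) by ring, abs_neg, abs_mul] at this
      refine le_trans (le_of_eq ?_) this
      congr 2 <;> push_cast <;> ring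
    calc ‖F y‖ * ‖cexp (-(y * I) * u) - cexp (-(y * I) * v)‖ ≤ ‖F y‖ * (|y| * |u - v|) :=
          mul_le_mul_of_nonneg_left h2 (norm_nonneg _)
      _ = |u - v| * (|y| * ‖F y‖) := by ring
      _ ≤ |u - v| * Ψ y := mul_le_mul_of_nonneg_left (hle y) (abs_nonneg _)
  rw [integral_const_mul, ← hdiff, norm_mul] at h1
  have hπ : 0 < 2 * π := by positivity
  rw [show ‖(2 : ℂ) * π‖ = 2 * π by
    rw [norm_mul, Complex.norm_real, Real.norm_of_nonneg Real.pi_pos.le]; simp] at h1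
  rw [le_inv_mul_iff₀ hπ]
  exact h1

/-- A majorant for `|y| ‖φ̂(1/2+iy)‖`: it is integrable for a Weil test `φ` (decay
`‖φ̂(1/2+iy)‖ ≤ D/(1+y²)²`). [folklore] -/
theorem exists_integrable_abs_mul_norm_weilMellin_line_le (hg : IsWeilTest g) :
    ∃ Ψ : ℝ → ℝ, Integrable Ψ ∧ ∀ y : ℝ, |y| * ‖weilMellin g (1 / 2 + y * I)‖ ≤ Ψ y := by
  obtain ⟨D, hD⟩ := exists_norm_weilMellin_half_le_sq hg
  have hD0 : 0 ≤ D := by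
    have := (norm_nonneg _).trans (hD 0)
    simpa using this
  refine ⟨fun y => D * (1 + y ^ 2)⁻¹, integrable_inv_one_add_sq.const_mul D, fun y => ?_⟩
  have hq : 0 < 1 + y ^ 2 := by positivity
  have hy : |y| ≤ 1 + y ^ 2 := by
    rcases le_total 0 y with h | h
    · rw [abs_of_nonneg h]; nlinarith
    · rw [abs_of_nonpos h]; nlinarith
  calc |y| * ‖weilMellin g (1 / 2 + y * I)‖ ≤ |y| * (D / (1 + y ^ 2) ^ 2) :=
        mul_le_mul_of_nonneg_left (hD y) (abs_nonneg _)
    _ ≤ (1 + y ^ 2) * (D / (1 + y ^ 2) ^ 2) := mul_le_mul_of_nonneg_right hy (by positivity)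
    _ = D * (1 + y ^ 2)⁻¹ := by field_simp

/-! ### The transform of a bounded window is Lipschitz along the critical line -/

/-- For `V` continuous with `tsupport V ⊆ [-B, B]`:
`‖V̂(1/2 + it) - V̂(1/2 + it')‖ ≤ |t - t'| · B · ∫ ‖V‖`. [folklore] -/
theorem norm_weilMellin_line_sub_le {V : ℝ → ℂ} (hV : Continuous V) (hVs : HasCompactSupport V)
    {B : ℝ} (hsupp : tsupport V ⊆ Icc (-B) B) (t t' : ℝ) :
    ‖weilMellin V (1 / 2 + t * I) - weilMellin V (1 / 2 + t' * I)‖ ≤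
      |t - t'| * B * ∫ u, ‖V u‖ := by
  rw [weilMellin_half_eq_integral, weilMellin_half_eq_integral]
  have hi : ∀ τ : ℝ, Integrable fun x : ℝ => V x * cexp (((x * τ : ℝ) : ℂ) * I) := fun τ =>
    (hV.mul (by fun_prop)).integrable_of_hasCompactSupport hVs.mul_right
  rw [← integral_sub (hi t) (hi t'), ← integral_const_mul]
  refine (norm_integral_le_integral_norm _).trans (integral_mono_of_nonneg
    (Eventually.of_forall fun _ => norm_nonneg _)
    ((hV.norm.const_mul _).integrable_of_hasCompactSupport hVs.norm.mul_left)
    (Eventually.of_forall fun x => ?_))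
  by_cases hx : V x = 0
  · simp [hx]
  · have hmem : x ∈ Icc (-B) B := hsupp (subset_tsupport _ (Function.mem_support.2 hx))
    have habs : |x| ≤ B := abs_le.2 ⟨hmem.1, hmem.2⟩
    show ‖V x * cexp (((x * t : ℝ) : ℂ) * I) - V x * cexp (((x * t' : ℝ) : ℂ) * I)‖ ≤
      |t - t'| * B * ‖V x‖
    rw [← mul_sub, norm_mul]
    have h1 : ‖cexp (((x * t : ℝ) : ℂ) * I) - cexp (((x * t' : ℝ) : ℂ) * I)‖ ≤ |t - t'| * B := by
      refine (norm_cexp_mul_I_sub_cexp_mul_I_le' _ _).trans ?_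
      rw [show x * t - x * t' = (t - t') * x by ring, abs_mul]
      exact mul_le_mul_of_nonneg_left habs (abs_nonneg _)
    calc ‖V x‖ * ‖cexp (((x * t : ℝ) : ℂ) * I) - cexp (((x * t' : ℝ) : ℂ) * I)‖
        ≤ ‖V x‖ * (|t - t'| * B) := mul_le_mul_of_nonneg_left h1 (norm_nonneg _)
      _ = |t - t'| * B * ‖V x‖ := by ring

/-! ### Extraction of pointwise convergent subsequences -/

/-- **Arzelà–Ascoli type extraction.** Let `V k : ℝ → ℂ` be uniformly bounded and uniformly
Lipschitz, and let `ν k : ℤ → ℝ` take values in fixed compact intervals. Then along some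
subsequence `V (φ k)` converges pointwise on all of `ℝ` and `ν (φ k)` converges coordinatewise
(sequential compactness of the countable products `(ℚ → closedBall 0 C) × Π_n [lo n, hi n]`,
then density of `ℚ` and the Lipschitz bound). [folklore] -/
theorem exists_subseq_tendsto_of_bounded_lipschitz {V : ℕ → ℝ → ℂ} {C L : ℝ}
    (hC : ∀ k u, ‖V k u‖ ≤ C) (hL : ∀ k u v, ‖V k u - V k v‖ ≤ L * |u - v|)
    {ν : ℕ → ℤ → ℝ} {lo hi : ℤ → ℝ} (hν : ∀ k n, ν k n ∈ Icc (lo n) (hi n)) :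
    ∃ (φ : ℕ → ℕ) (Vlim : ℝ → ℂ) (μ : ℤ → ℝ), StrictMono φ ∧
      (∀ u, Tendsto (fun k => V (φ k) u) atTop (𝓝 (Vlim u))) ∧
      (∀ n, Tendsto (fun k => ν (φ k) n) atTop (𝓝 (μ n))) ∧
      (∀ n, μ n ∈ Icc (lo n) (hi n)) := by
  -- the compact metrisable space `(ℚ → closedBall 0 C) × (Π_n Icc)`
  set X : ℕ → (ℚ → ℂ) × (ℤ → ℝ) := fun k => (fun q => V k q, ν k) with hX
  set Kset : Set ((ℚ → ℂ) × (ℤ → ℝ)) :=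
    (Set.univ.pi fun _ : ℚ => closedBall (0 : ℂ) C) ×ˢ (Set.univ.pi fun n : ℤ => Icc (lo n) (hi n))
    with hKset
  have hKc : IsCompact Kset :=
    (isCompact_univ_pi fun _ => isCompact_closedBall _ _).prod
      (isCompact_univ_pi fun n => isCompact_Icc)
  have hXK : ∀ k, X k ∈ Kset := by
    intro k
    refine ⟨fun q _ => ?_, fun n _ => hν k n⟩
    simpa using hC k q
  obtain ⟨⟨w, μ⟩, hwμ, φ, hφ, hlim⟩ := hKc.tendsto_subseq hXK
  have hlim1 : ∀ q : ℚ, Tendsto (fun k => V (φ k) q) atTop (𝓝 (w q)) := by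
    intro q
    have h1 := (continuous_apply q).continuousAt.tendsto.comp
      ((continuous_fst.tendsto _).comp hlim)
    exact h1
  have hlim2 : ∀ n : ℤ, Tendsto (fun k => ν (φ k) n) atTop (𝓝 (μ n)) := by
    intro n
    exact (continuous_apply n).continuousAt.tendsto.comp ((continuous_snd.tendsto _).comp hlim)
  have hμmem : ∀ n, μ n ∈ Icc (lo n) (hi n) := fun n => hwμ.2 n (mem_univ _)
  -- pointwise Cauchy on all of `ℝ`
  have hL0 : 0 ≤ L := by
    have := hL 0 0 1
    have h1 : (0 : ℝ) ≤ L * |(0 : ℝ) - 1| := (norm_nonneg _).trans this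
    simpa using h1
  have hcauchy : ∀ u : ℝ, CauchySeq fun k => V (φ k) u := by
    intro u
    rw [Metric.cauchySeq_iff]
    intro ε hε
    -- a rational `q` with `L |u - q| < ε/3`
    obtain ⟨q, hq⟩ : ∃ q : ℚ, L * |u - q| < ε / 3 := by
      obtain ⟨q, hq1, hq2⟩ := exists_rat_btwn (show u - ε / (3 * (L + 1)) < u by
        have : 0 < ε / (3 * (L + 1)) := by positivity
        linarith)
      refine ⟨q, ?_⟩
      have habs : |u - q| < ε / (3 * (L + 1)) := by rw [abs_lt]; constructor <;> linarith
      calc L * |u - q| ≤ (L + 1) * |u - q| :=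
            mul_le_mul_of_nonneg_right (by linarith) (abs_nonneg _)
        _ < (L + 1) * (ε / (3 * (L + 1))) := mul_lt_mul_of_pos_left habs (by linarith)
        _ = ε / 3 := by field_simp
    obtain ⟨N, hN⟩ := Metric.cauchySeq_iff.1 (hlim1 q).cauchySeq (ε / 3) (by positivity)
    refine ⟨N, fun m hm n hn => ?_⟩
    have h1 := hN m hm n hn
    rw [dist_eq_norm] at h1 ⊢
    have h2 := hL (φ m) u q
    have h3 := hL (φ n) q u
    rw [abs_sub_comm] at h3
    calc ‖V (φ m) u - V (φ n) u‖
        = ‖(V (φ m) u - V (φ m) q) + (V (φ m) q - V (φ n) q) + (V (φ n) q - V (φ n) u)‖ := by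
          congr 1; ring
      _ ≤ ‖V (φ m) u - V (φ m) q‖ + ‖V (φ m) q - V (φ n) q‖ + ‖V (φ n) q - V (φ n) u‖ :=
          norm_add₃_le
      _ < ε / 3 + ε / 3 + ε / 3 := by gcongr <;> linarith
      _ = ε := by ring
  refine ⟨φ, fun u => limUnder atTop fun k => V (φ k) u, μ, hφ, fun u => ?_, hlim2, hμmem⟩
  exact tendsto_nhds_limUnder (cauchySeq_tendsto_of_complete (hcauchy u))

end Literature.NumberTheory.LFunctions

end
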